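import Summits.KontsevichZagierPeriods.KontsevichZagierPeriods.Theorems.GammaHodgeSector.Negative.Algebraicity
import Literature.ModelTheory.ExponentialFields.TarskiSeidenbergProofs

/-!
# `CompleteModGammaSector` (stmt-KontsevichZagierPeriods-14233) — negative side III-a: a
`ℚ`-semialgebraic function of one variable takes algebraic values at algebraic points

Landed copy of §5.1 of `Cruxes/GammaSectorComplete/Disproof.lean` (tools for the rule-(2)
necessity theorem of `Negative/RuleTwoWitness.lean`): `isAlgebraic_of_mem_finite` (points of a
finite `ℚ`-semialgebraic subset of `ℝ¹` are algebraic, from `exists_clopen_off_zeros`) and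
`isAlgebraic_apply_of_isAlgebraic` (cut the graph by a rational equation of the point, swap the
coordinates, project by the tree's `tarski_seidenberg_real_holds`, and apply the former). No
definitions (review p81843: the group of real algebraic numbers is Mathlib's `algebraicClosure ℚ ℝ`,
used directly downstream; the dimension-0 case is the landed
`LiouvilleUnfolding.LogPrimitiveNL.Negative.isAlgebraic_of_isSemialgebraicFunOn_fin_zero`).
-/

noncomputable section

open MeasureTheory Set
open scoped BigOperators

namespace Summit.KontsevichZagierPeriods.CompleteModGammaSectorNegative

open Literature.NumberTheory.Transcendental
open Literature.NumberTheory.Transcendental.KZ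
open Summit.KontsevichZagierPeriods.KontsevichZagierPeriods.Theses.TerasomaMultiplication
  (CompleteModGammaSector GammaHodgeSector)
open Summit.KontsevichZagierPeriods.GammaHodgeSectorNegative
open Literature.Barriers.KontsevichZagierPeriods.KZ (constRep constRep_value constRep_isRational)

open Literature.ModelTheory.ExponentialFields (IsSemialgebraic isSemialgebraic_setOf_eval_le
  isSemialgebraic_setOf_eval_eq_zero tarski_seidenberg_real_holds)

/-! ### §5.1 Semialgebraic functions of one variable at algebraic points -/

/-- **Points of a finite `ℚ`-semialgebraic subset of `ℝ¹` are algebraic** (off the zero set of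
the rational polynomial of `exists_clopen_off_zeros` the set is open, hence locally an interval,
hence infinite). [folklore] -/
theorem isAlgebraic_of_mem_finite {S : Set (Fin 1 → ℝ)} (hS : IsSemialgebraic ℚ S) (hfin : S.Finite)
    {w : Fin 1 → ℝ} (hw : w ∈ S) : IsAlgebraic ℚ (w 0) := by
  obtain ⟨q, hq0, hopen, -⟩ := exists_clopen_off_zeros hS
  by_cases hroot : Polynomial.aeval (w 0) q = 0
  · exact ⟨q, hq0, hroot⟩
  · exfalso
    have hmem : w ∈ S ∩ {v | Polynomial.aeval (v 0) q ≠ 0} := ⟨hw, hroot⟩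
    obtain ⟨ε, hε, hball⟩ := Metric.isOpen_iff.mp hopen w hmem
    have hsub : ∀ t ∈ Ioo (0:ℝ) ε, (fun _ : Fin 1 => w 0 + t) ∈ S := by
      intro t ht
      refine (hball ?_).1
      rw [Metric.mem_ball, dist_pi_lt_iff hε]
      intro i
      rw [Subsingleton.elim i 0, Real.dist_eq, add_sub_cancel_left, abs_of_pos ht.1]
      exact ht.2
    have hinj : Set.InjOn (fun t : ℝ => (fun _ : Fin 1 => w 0 + t)) (Ioo (0:ℝ) ε) := by
      intro t _ t' _ h
      have := congr_fun h 0
      simpa using this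
    have hinf : (Ioo (0:ℝ) ε).Infinite := Ioo_infinite hε
    exact hinf (Set.Finite.of_finite_image (hfin.subset (by rintro _ ⟨t, ht, rfl⟩; exact hsub t ht)) hinj)

/-- **A `ℚ`-semialgebraic function of one variable takes algebraic values at algebraic points.**
Cut the graph by `p(x₀) = 0` (`p` a non-zero rational polynomial vanishing at the point): a finite
`ℚ`-semialgebraic subset of `ℝ²`; swap the coordinates and project (Tarski–Seidenberg, tree:
`tarski_seidenberg_real_holds`) to a finite `ℚ`-semialgebraic subset of `ℝ¹` containing the
value. [folklore] -/
theorem isAlgebraic_apply_of_isAlgebraic {s : Set (Fin 1 → ℝ)} {f : (Fin 1 → ℝ) → ℝ}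
    (hf : IsSemialgebraicFunOn ℚ s f) {w : Fin 1 → ℝ} (hw : w ∈ s) (halg : IsAlgebraic ℚ (w 0)) :
    IsAlgebraic ℚ (f w) := by
  obtain ⟨p, hp0, hpw⟩ := halg
  -- the graph, cut by `p (z 0) = 0`
  have hΓ := (isSemialgebraicFunOn_iff.mp hf)
  set P : MvPolynomial (Fin 2) ℚ := Polynomial.aeval (MvPolynomial.X 0) p with hPdef
  have hP : ∀ z : Fin 2 → ℝ, MvPolynomial.aeval z P = Polynomial.aeval (z 0) p := by
    intro z
    rw [hPdef, ← Polynomial.aeval_algHom_apply, MvPolynomial.aeval_X]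
  set T : Set (Fin 2 → ℝ) :=
    {z : Fin (1 + 1) → ℝ | Fin.init z ∈ s ∧ z (Fin.last 1) = f (Fin.init z)} ∩
      {z | MvPolynomial.aeval z P = 0} with hTdef
  have hT : IsSemialgebraic ℚ T := hΓ.inter (isSemialgebraic_setOf_eval_eq_zero P)
  -- `T` is finite: it injects into the real roots of `p`
  have hinit : ∀ z : Fin 2 → ℝ, Fin.init z = fun _ : Fin 1 => z 0 := by
    intro z
    funext i
    rw [Subsingleton.elim i 0]
    rfl
  have hTfin : T.Finite := by
    refine (((p.rootSet_finite ℝ).image fun ρ : ℝ =>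
      (Fin.snoc (fun _ : Fin 1 => ρ) (f fun _ => ρ) : Fin 2 → ℝ))).subset ?_
    rintro z ⟨⟨-, hz2⟩, hz3⟩
    refine ⟨z 0, ?_, ?_⟩
    · rw [Polynomial.mem_rootSet]
      exact ⟨hp0, by rw [← hP z]; exact hz3⟩
    · show Fin.snoc (fun _ : Fin 1 => z 0) (f fun _ : Fin 1 => z 0) = z
      rw [← hinit z, ← hz2]
      exact Fin.snoc_init_self z
  -- swap the coordinates and project away the last one
  set σ : Fin 2 → Fin 2 := ⇑(Equiv.swap (0 : Fin 2) 1) with hσdef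
  set T' : Set (Fin 1 → ℝ) :=
    (fun x : Fin (1 + 1) → ℝ => x ∘ Fin.castSucc) '' ((fun x : Fin 2 → ℝ => x ∘ σ) ⁻¹' T) with hT'def
  have hT' : IsSemialgebraic ℚ T' := tarski_seidenberg_real_holds (hT.preimage_comp σ)
  have hT'fin : T'.Finite := by
    refine (hTfin.preimage ?_).image _
    intro x _ y _ hxy
    funext i
    have h := congr_fun hxy (σ i)
    simp only [Function.comp_apply] at h
    rw [hσdef, Equiv.swap_apply_self] at h
    exact h
  -- the value sits in `T'`
  have hmem : (fun _ : Fin 1 => f w) ∈ T' := by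
    refine ⟨Fin.snoc (fun _ : Fin 1 => f w) (w 0), ?_, ?_⟩
    · show (fun i => (Fin.snoc (fun _ : Fin 1 => f w) (w 0) : Fin 2 → ℝ) (σ i)) ∈ T
      have hz : (fun i => (Fin.snoc (fun _ : Fin 1 => f w) (w 0) : Fin 2 → ℝ) (σ i)) =
          Fin.snoc w (f w) := by
        funext i
        fin_cases i
        · simp [hσdef, Fin.snoc]
        · simp [hσdef, Fin.snoc]
      rw [hz]
      refine ⟨⟨by simpa using hw, by rw [Fin.snoc_last, Fin.init_snoc]⟩, ?_⟩
      show MvPolynomial.aeval (Fin.snoc w (f w) : Fin 2 → ℝ) P = 0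
      rw [hP]
      simpa [Fin.snoc] using hpw
    · funext i
      rw [Subsingleton.elim i 0]
      simp [Fin.snoc]
  simpa using isAlgebraic_of_mem_finite hT' hT'fin hmem

end Summit.KontsevichZagierPeriods.CompleteModGammaSectorNegative
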